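import Mathlib
import HarnessLib
import Summits.CriticalPhenomena.SAWScalingLimit.Theses.SAWPhaseRetrieval
import Summits.CriticalPhenomena.SAWScalingLimit.Theorems.SAWPhaseRetrievalRetrievalSynthesisRRiemann
import Literature.Probability.RandomPlanarGeometry.HexParafermionProofs
import Literature.Barriers.CriticalPhenomena.ParafermionicHalfCauchyRiemann
import Literature.Analysis.FluidPDE.HarnackChainCover

/-!
# `RetrievalSynthesisR` (stmt-CriticalPhenomena-14011, route `SAWPhaseRetrieval`): the layer-1 glue
`PhaseLawR → RetrievalStabilityR → BoundaryAnchoring → HexObservableLimitR`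

Pure analysis. The universal constant is `c := 2√3 · c_B · u` (`u` the unit of the phase law, `c_B`
the anchoring constant, `2√3` the mid-edge density of the honeycomb lattice in `hexCenter` units).
* `RetrievalSynthesisR.core`: for an open connected `U`, domains `Λ δ` exhausting its compacts,
  mid-edge functions `F δ` with the vertex relations, a normaliser `b δ`, `L` continuous on `U` with
  `L → L_b` at `p₁`, a test function `ψ` supported in `U`: PHASE LAW + RETRIEVAL STABILITY + BOUNDARY
  ANCHORING give `δ² Σ ψ F/F(b) - c_B u δ² Σ ψ e^{(5/8)(L - L_b)} → 0`. Proof: rotate `F` by the unit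
  `w = conj(unit F(b)) conj(u) e^{i(5/8) Im L_b}` (the relations are `ℂ`-linear), read the phase law
  as the stability hypothesis on a preconnected compact `K' ⊇ tsupport ψ ∪ B`
  (`Literature.Analysis.FluidPDE.exists_isCompact_isConnected_superset`; `B` an anchoring ball on
  which `L ≈ L_b`), pin the free scalar `s` through `B` (`kappa_bounds`, lower mid-edge count of
  `B`), and sum the modulus/argument splitting over `tsupport ψ` (`pointwise_bound`, upper count,
  `final_bound`).
* `retrievalSynthesisR_proof`: the observable `F(a_δ, ·, x_c, 5/8)` satisfies the vertex relations
  (Duminil-Copin–Smirnov 2012, Lemma 1, PROVED: `DuminilCopinSmirnov2012_lemma1_holds`; `a_δ ∈ ∂Ω_δ`,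
  `Ω_δ` simply connected), `L = log Φ'` is holomorphic (`differentiableOn_of_exp_eq`), `core`, and
  the honeycomb Riemann sums `δ² Σ_e g(δ·mid e) → 2√3 ∫ g` (`tendsto_domain_sum`).
-/

noncomputable section

namespace Summit.CriticalPhenomena.SAWScalingLimit.Theorems.RetrievalSynthesisR

open scoped BigOperators Topology ComplexConjugate
open Filter Set Metric MeasureTheory Complex
open Literature.Probability.LatticeModels Literature.Probability.RandomPlanarGeometry.SAW
open Literature.Barriers.CriticalPhenomena

/-- **The analytic core of the synthesis** (see the module docstring). -/
theorem core {U : Set ℂ} (hUo : IsOpen U) (hUc : IsConnected U) (Λ : ℝ → Finset HexVertex)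
    (hexh : ∀ K : Set ℂ, IsCompact K → K ⊆ U → ∀ᶠ δ : ℝ in 𝓝[>] 0,
      ∀ v : HexVertex, (δ : ℂ) * hexCenter v ∈ K → v ∈ Λ δ)
    (F : ℝ → Sym2 HexVertex → ℂ) (b : ℝ → Sym2 HexVertex) (L : ℂ → ℂ) (Lb p₁ : ℂ)
    (hLc : ContinuousOn L U) (hLb : Tendsto L (𝓝[U] p₁) (𝓝 Lb))
    {ψ : ℂ → ℂ} (hψc : Continuous ψ) (hψs : HasCompactSupport ψ) (hψU : tsupport ψ ⊆ U)
    {u : ℂ} (hu : ‖u‖ = 1) {cB : ℝ} (hcB : 0 < cB)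
    (hRel : ∀ᶠ δ : ℝ in 𝓝[>] 0, SatisfiesVertexRelations (Λ δ) (F δ))
    (hPhase : ∀ K : Set ℂ, IsCompact K → K ⊆ U → ∀ ε : ℝ, 0 < ε → ∀ᶠ δ : ℝ in 𝓝[>] 0,
      ∀ e ∈ {e | e ∈ hexDomainMidEdges (Λ δ) ∧ (δ : ℂ) * hexMidpoint e ∈ K},
        F δ e ≠ 0 ∧ ‖(F δ e / F δ (b δ)) / ((‖F δ e / F δ (b δ)‖ : ℝ) : ℂ) -
          u * Complex.exp (Complex.I * (5 / 8 : ℂ) *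
            (((L ((δ : ℂ) * hexMidpoint e) - Lb).im : ℝ) : ℂ))‖ ≤ ε)
    (hStab : ∀ K : Set ℂ, IsCompact K → IsPreconnected K → ∀ r : ℝ, 0 < r →
      Metric.cthickening r K ⊆ U → ∀ η : ℝ, 0 < η → ∃ ε : ℝ, 0 < ε ∧ ∀ᶠ δ : ℝ in 𝓝[>] 0,
        ∀ G : Sym2 HexVertex → ℂ, SatisfiesVertexRelations (Λ δ) G →
          (∀ e ∈ {e | e ∈ hexDomainMidEdges (Λ δ) ∧
              (δ : ℂ) * hexMidpoint e ∈ Metric.cthickening r K},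
            G e ≠ 0 ∧ ‖G e / ((‖G e‖ : ℝ) : ℂ) - Complex.exp (Complex.I * (5 / 8 : ℂ) *
              (((L ((δ : ℂ) * hexMidpoint e)).im : ℝ) : ℂ))‖ ≤ ε) →
          ∃ s : ℝ, 0 < s ∧ δ ^ 2 * (∑ᶠ e ∈ {e | e ∈ hexDomainMidEdges (Λ δ) ∧
            (δ : ℂ) * hexMidpoint e ∈ K},
            |‖G e‖ / s - ‖Complex.exp ((5 / 8 : ℂ) * L ((δ : ℂ) * hexMidpoint e))‖|) ≤ η)
    (hAnch : ∀ ε : ℝ, 0 < ε → ∃ z₀ ∈ U, ∃ r₀ : ℝ, 0 < r₀ ∧ dist z₀ p₁ + r₀ < ε ∧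
      Metric.closedBall z₀ r₀ ⊆ U ∧ ∀ᶠ δ : ℝ in 𝓝[>] 0,
        ∀ e ∈ {e | e ∈ hexDomainMidEdges (Λ δ) ∧ (δ : ℂ) * hexMidpoint e ∈ Metric.closedBall z₀ r₀},
          |‖F δ e‖ / ‖F δ (b δ)‖ - cB| ≤ ε) :
    ∀ η₀ : ℝ, 0 < η₀ → ∀ᶠ δ : ℝ in 𝓝[>] 0,
      ‖(δ : ℂ) ^ 2 * (∑ᶠ e ∈ hexDomainMidEdges (Λ δ), ψ ((δ : ℂ) * hexMidpoint e) * F δ e) /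
          F δ (b δ) -
        (cB : ℂ) * u * ((δ : ℂ) ^ 2 * ∑ᶠ e ∈ hexDomainMidEdges (Λ δ),
          ψ ((δ : ℂ) * hexMidpoint e) *
            Complex.exp ((5 / 8 : ℂ) * (L ((δ : ℂ) * hexMidpoint e) - Lb)))‖ ≤ η₀ := by
  intro η₀ hη₀
  classical
  set K₀ := tsupport ψ with hK₀
  have hK₀c : IsCompact K₀ := hψs
  obtain ⟨Mψ, hMψ⟩ := hψc.bounded_above_of_compact_support hψs
  have hMψ0 : 0 ≤ Mψ := (norm_nonneg _).trans (hMψ 0)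
  set Λb : ℝ := Real.exp (5 / 8 * Lb.re) with hΛb
  have hΛb0 : 0 < Λb := by rw [hΛb]; exact Real.exp_pos _
  clear_value Λb
  set E : ℂ → ℂ := fun z => Complex.exp ((5 / 8 : ℂ) * (L z - Lb)) with hE
  have hEc : ContinuousOn E U :=
    Complex.continuous_exp.comp_continuousOn (continuousOn_const.mul (hLc.sub continuousOn_const))
  have hEnorm : ∀ z, ‖E z‖ = Real.exp (5 / 8 * (L z - Lb).re) := fun z => norm_exp_mul _
  have hEne : ∀ z, E z ≠ 0 := fun z => Complex.exp_ne_zero _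
  obtain ⟨MH₀, hMH₀⟩ := hK₀c.exists_bound_of_continuousOn (hEc.mono hψU)
  set MH : ℝ := max MH₀ 1 with hMH
  have hMH0 : 0 < MH := by rw [hMH]; exact lt_max_of_lt_right one_pos
  have hMH1 : ∀ z ∈ K₀, ‖E z‖ ≤ MH := fun z hz => by rw [hMH]; exact (hMH₀ z hz).trans (le_max_left _ _)
  clear_value MH
  obtain ⟨N, hN0, eN⟩ := eventually_count_le hUo Λ hexh hK₀c hψU
  set τ : ℝ := min (cB / 2) (η₀ / (3 * (Mψ + 1) * MH * N)) with hτ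
  have hτ0 : 0 < τ := by positivity
  have hτ1 : τ ≤ cB / 2 := min_le_left _ _
  have hτ2 : τ ≤ η₀ / (3 * (Mψ + 1) * MH * N) := min_le_right _ _
  clear_value τ
  set κmax : ℝ := 2 * cB / Λb with hκmax
  have hκmax0 : 0 < κmax := by positivity
  clear_value κmax
  set ε₂ : ℝ := min 1 (τ / (10 * cB)) with hε₂
  have hε₂0 : 0 < ε₂ := by positivity
  have hε₂1 : ε₂ ≤ 1 := min_le_left _ _
  have hε₂2 : ε₂ ≤ τ / (10 * cB) := min_le_right _ _
  clear_value ε₂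
  obtain ⟨θL, hθL0, hθL⟩ : ∃ θ > 0, ∀ z ∈ U, dist z p₁ < θ → dist (L z) Lb < ε₂ := by
    obtain ⟨θ, hθ, h⟩ := Metric.tendsto_nhdsWithin_nhds.1 hLb ε₂ hε₂0
    exact ⟨θ, hθ, fun z hz hd => h hz hd⟩
  set ε₁ : ℝ := min (τ / 4) θL with hε₁
  have hε₁0 : 0 < ε₁ := by positivity
  have hε₁1 : ε₁ ≤ τ / 4 := min_le_left _ _
  have hε₁2 : ε₁ ≤ θL := min_le_right _ _
  clear_value ε₁
  obtain ⟨z₀, hz₀U, r₀, hr₀, hdist, hBU, eA⟩ := hAnch ε₁ hε₁0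
  set B := Metric.closedBall z₀ r₀ with hB
  have hBc : IsCompact B := isCompact_closedBall _ _
  have hLB : ∀ z ∈ B, ‖L z - Lb‖ < ε₂ := by
    intro z hz
    have hzθ : dist z p₁ < θL := by
      calc dist z p₁ ≤ dist z z₀ + dist z₀ p₁ := dist_triangle _ _ _
        _ ≤ r₀ + dist z₀ p₁ := by gcongr; exact mem_closedBall.1 hz
        _ < ε₁ := by linarith
        _ ≤ θL := hε₁2
    rw [← dist_eq_norm]; exact hθL z (hBU hz) hzθ
  obtain ⟨α₀, hα₀, eα⟩ := eventually_le_count hUo Λ hexh hr₀ hBU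
  set η : ℝ := min (τ * α₀ * Λb / (8 * cB)) (η₀ / (3 * (Mψ + 1) * κmax)) with hη
  have hη0 : 0 < η := by positivity
  have hη1 : η ≤ τ * α₀ * Λb / (8 * cB) := min_le_left _ _
  have hη2 : η ≤ η₀ / (3 * (Mψ + 1) * κmax) := min_le_right _ _
  clear_value η
  obtain ⟨K', hK'c, hK'conn, hK'sub, hK'U⟩ :=
    Literature.Analysis.FluidPDE.exists_isCompact_isConnected_superset hUo hUc (hK₀c.union hBc)
      (union_subset hψU hBU) ⟨z₀, Or.inr (mem_closedBall_self hr₀.le)⟩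
  have hK₀K' : K₀ ⊆ K' := subset_union_left.trans hK'sub
  have hBK' : B ⊆ K' := subset_union_right.trans hK'sub
  obtain ⟨r, hr, hrU⟩ := hK'c.exists_cthickening_subset_open hUo hK'U
  set K'' := Metric.cthickening r K' with hK''
  have hK''c : IsCompact K'' := hK'c.cthickening
  have hK'K'' : K' ⊆ K'' := self_subset_cthickening _
  obtain ⟨εR, hεR0, eS⟩ := hStab K' hK'c hK'conn.isPreconnected r hr hrU η hη0
  set εp : ℝ := min (min εR (1 / 2)) (η₀ / (3 * (Mψ + 1) * (κmax * (η + Λb * MH * N) + 1)))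
    with hεp
  have hεp0 : 0 < εp := by positivity
  have hεpR : εp ≤ εR := (min_le_left _ _).trans (min_le_left _ _)
  have hεph : εp ≤ 1 / 2 := (min_le_left _ _).trans (min_le_right _ _)
  have hεp3 : εp ≤ η₀ / (3 * (Mψ + 1) * (κmax * (η + Λb * MH * N) + 1)) := min_le_right _ _
  clear_value εp
  have eP := hPhase K'' hK''c hrU εp hεp0
  /- the good event -/
  filter_upwards [eN, eA, eα, eS, eP, hRel, self_mem_nhdsWithin] with δ hNδ hAδ hαδ hSδ hPδ hRelδ hδpos
  have hδ : 0 < δ := hδpos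
  have hδ2 : 0 < δ ^ 2 := by positivity
  have hMEfin := Set.finite_coe_iff.1 (finite_hexDomainMidEdges (Λ δ))
  set MEf := hMEfin.toFinset with hMEf
  have hmem : ∀ e, e ∈ MEf ↔ e ∈ hexDomainMidEdges (Λ δ) := fun e => Set.Finite.mem_toFinset _
  set T0 := MEf.filter (fun e => (δ : ℂ) * hexMidpoint e ∈ K₀) with hT0
  set TB := MEf.filter (fun e => (δ : ℂ) * hexMidpoint e ∈ B) with hTB
  set T' := MEf.filter (fun e => (δ : ℂ) * hexMidpoint e ∈ K') with hT'
  have hT0T' : T0 ⊆ T' := by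
    intro e he; rw [Finset.mem_filter] at he ⊢; exact ⟨he.1, hK₀K' he.2⟩
  have hTBT' : TB ⊆ T' := by
    intro e he; rw [Finset.mem_filter] at he ⊢; exact ⟨he.1, hBK' he.2⟩
  have hcntN : δ ^ 2 * (T0.card : ℝ) ≤ N := by
    rw [finsum_mem_eq_filter_sum hMEfin] at hNδ
    simpa only [Finset.sum_const, nsmul_eq_mul, mul_one] using hNδ
  have hcntα : α₀ ≤ δ ^ 2 * (TB.card : ℝ) := by
    rw [finsum_mem_eq_filter_sum hMEfin] at hαδ
    simpa only [Finset.sum_const, nsmul_eq_mul, mul_one] using hαδ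
  /- the normaliser does not vanish -/
  obtain ⟨e₁, he₁⟩ : TB.Nonempty := by
    rw [← Finset.card_pos]
    by_contra h
    push Not at h
    have : (TB.card : ℝ) = 0 := by exact_mod_cast Nat.le_zero.1 h
    rw [this, mul_zero] at hcntα
    exact absurd hcntα (not_le.2 hα₀)
  have he₁' : e₁ ∈ hexDomainMidEdges (Λ δ) ∧ (δ : ℂ) * hexMidpoint e₁ ∈ K'' := by
    rw [hTB, Finset.mem_filter, hmem] at he₁
    exact ⟨he₁.1, hK'K'' (hBK' he₁.2)⟩
  have hFb : F δ (b δ) ≠ 0 := by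
    intro h0
    have h := (hPδ e₁ he₁').2
    rw [h0, div_zero, zero_div, zero_sub, norm_neg, norm_mul, hu, one_mul, norm_exp_I_mul] at h
    linarith
  have hFbn : 0 < ‖F δ (b δ)‖ := norm_pos_iff.2 hFb
  /- the rotated observable -/
  set w : ℂ := conj (F δ (b δ) / ((‖F δ (b δ)‖ : ℝ) : ℂ)) * conj u *
    Complex.exp (Complex.I * (5 / 8 : ℂ) * ((Lb.im : ℝ) : ℂ)) with hw
  have hw1 : ‖w‖ = 1 := by
    rw [hw, norm_mul, norm_mul, Complex.norm_conj, norm_div_norm hFb, Complex.norm_conj, hu,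
      norm_exp_I_mul]; norm_num
  have hw0 : w ≠ 0 := fun h => by rw [h, norm_zero] at hw1; exact zero_ne_one hw1
  set G : Sym2 HexVertex → ℂ := fun e => w * F δ e with hG
  have hSVR : SatisfiesVertexRelations (Λ δ) G := hRelδ.smul w
  have hGn : ∀ e, ‖G e‖ = ‖F δ e‖ := fun e => by rw [hG]; simp only; rw [norm_mul, hw1, one_mul]
  have hphG : ∀ e, e ∈ hexDomainMidEdges (Λ δ) ∧ (δ : ℂ) * hexMidpoint e ∈ K'' →
      G e ≠ 0 ∧ ‖G e / ((‖G e‖ : ℝ) : ℂ) - Complex.exp (Complex.I * (5 / 8 : ℂ) *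
        (((L ((δ : ℂ) * hexMidpoint e)).im : ℝ) : ℂ))‖ ≤ εR := by
    intro e he
    obtain ⟨hFe, hph⟩ := hPδ e he
    refine ⟨mul_ne_zero hw0 hFe, ?_⟩
    have eG : G e = F δ e * (conj (F δ (b δ) / ((‖F δ (b δ)‖ : ℝ) : ℂ)) * conj u *
        Complex.exp (Complex.I * (5 / 8 : ℂ) * ((Lb.im : ℝ) : ℂ))) := by
      rw [hG]; simp only; rw [hw]; ring
    rw [eG, norm_rotate_phase (F δ e) (F δ (b δ)) u _ Lb.im hFb hu, ← Complex.sub_im]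
    exact hph.trans hεpR
  obtain ⟨s, hs0, hL1⟩ := hSδ G hSVR hphG
  rw [finsum_mem_eq_filter_sum hMEfin] at hL1
  simp only [hGn] at hL1
  set κ : ℝ := s / ‖F δ (b δ)‖ with hκ
  have hκ0 : 0 < κ := by rw [hκ]; positivity
  clear_value κ
  set f : Sym2 HexVertex → ℝ := fun e => ‖F δ e‖ / s with hf
  set Hh : Sym2 HexVertex → ℝ := fun e =>
    ‖Complex.exp ((5 / 8 : ℂ) * L ((δ : ℂ) * hexMidpoint e))‖ with hHh
  set ρ : Sym2 HexVertex → ℝ := fun e => ‖F δ e‖ / ‖F δ (b δ)‖ with hρ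
  have hρf : ∀ e, ρ e = κ * f e := fun e => by
    rw [hρ, hκ, hf]; simp only; field_simp
  have hHhE : ∀ e, ‖E ((δ : ℂ) * hexMidpoint e)‖ * Λb = Hh e := fun e => by
    simp only [hHh, hΛb, hE]
    exact (norm_exp_mul_eq _ Lb).symm
  have hL1' : δ ^ 2 * ∑ e ∈ T', |f e - Hh e| ≤ η := hL1
  have hL1B : δ ^ 2 * ∑ e ∈ TB, |f e - Hh e| ≤ η :=
    le_trans (mul_le_mul_of_nonneg_left
      (Finset.sum_le_sum_of_subset_of_nonneg hTBT' fun _ _ _ => abs_nonneg _) hδ2.le) hL1'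
  have hL10 : δ ^ 2 * ∑ e ∈ T0, |f e - Hh e| ≤ η :=
    le_trans (mul_le_mul_of_nonneg_left
      (Finset.sum_le_sum_of_subset_of_nonneg hT0T' fun _ _ _ => abs_nonneg _) hδ2.le) hL1'
  have hHB : ∀ e ∈ TB, |Hh e - Λb| ≤ Λb * (5 / 4 * ε₂) := by
    intro e he
    rw [hTB, Finset.mem_filter] at he
    have hz := hLB _ he.2
    rw [← hHhE e, hEnorm]
    have hx : |5 / 8 * (L ((δ : ℂ) * hexMidpoint e) - Lb).re| ≤ 5 / 8 * ε₂ := by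
      rw [abs_mul, abs_of_pos (by norm_num : (0 : ℝ) < 5 / 8)]
      exact mul_le_mul_of_nonneg_left ((abs_re_le_norm _).trans hz.le) (by norm_num)
    have hx1 : |5 / 8 * (L ((δ : ℂ) * hexMidpoint e) - Lb).re| ≤ 1 := hx.trans (by linarith)
    have key := Real.abs_exp_sub_one_le hx1
    rw [show Real.exp (5 / 8 * (L ((δ : ℂ) * hexMidpoint e) - Lb).re) * Λb - Λb =
      Λb * (Real.exp (5 / 8 * (L ((δ : ℂ) * hexMidpoint e) - Lb).re) - 1) by ring, abs_mul,
      abs_of_pos hΛb0]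
    exact mul_le_mul_of_nonneg_left (key.trans (by linarith)) hΛb0.le
  have hρB : ∀ e ∈ TB, |ρ e - cB| ≤ ε₁ := by
    intro e he
    rw [hTB, Finset.mem_filter, hmem] at he
    exact hAδ e he
  obtain ⟨i1, i2⟩ := kappa_bounds TB f Hh ρ hδ2 hα₀ hcntα hΛb0 hκ0 hL1B hHB hρB (fun e _ => hρf e)
  set θ : ℝ := 5 / 4 * ε₂ + η / (α₀ * Λb) with hθ
  have hcBne : cB ≠ 0 := hcB.ne'
  have hθ1 : 5 / 4 * ε₂ ≤ τ / (8 * cB) := by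
    calc 5 / 4 * ε₂ ≤ 5 / 4 * (τ / (10 * cB)) := by gcongr
      _ = τ / (8 * cB) := by field_simp; ring
  have hθ2 : η / (α₀ * Λb) ≤ τ / (8 * cB) := by
    rw [div_le_iff₀ (by positivity)]
    calc η ≤ τ * α₀ * Λb / (8 * cB) := hη1
      _ = τ / (8 * cB) * (α₀ * Λb) := by ring
  have hθ3 : τ / (8 * cB) ≤ 1 / 16 := by
    rw [div_le_iff₀ (by positivity)]; linarith
  have hθ0 : 0 ≤ θ := by positivity
  have hθhalf : θ ≤ 1 / 2 := by linarith
  have hXc := abs_sub_le_of_kappa_bounds (X := κ * Λb) hcB.le hε₁0.le hθ0 hθhalf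
    (by calc κ * Λb * (1 - θ) = κ * Λb * (1 - 5 / 4 * ε₂) - κ * Λb * (η / (α₀ * Λb)) := by ring
          _ ≤ cB + ε₁ := i1)
    (by calc cB - ε₁ ≤ κ * Λb * (1 + 5 / 4 * ε₂) + κ * Λb * (η / (α₀ * Λb)) := i2
          _ = κ * Λb * (1 + θ) := by ring)
  have hθle : θ ≤ τ / (8 * cB) + τ / (8 * cB) := add_le_add hθ1 hθ2
  have hX : |κ * Λb - cB| ≤ τ := by
    calc |κ * Λb - cB| ≤ 2 * ε₁ + 2 * cB * θ := hXc
      _ ≤ 2 * (τ / 4) + 2 * cB * (τ / (8 * cB) + τ / (8 * cB)) := by gcongr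
      _ = τ := by field_simp; ring
  have hκle : κ ≤ κmax := by
    have h1 : κ * Λb ≤ 2 * cB := by
      have := (abs_le.1 hX).2; linarith
    rw [hκmax, le_div_iff₀ hΛb0]; exact h1
  /- the main estimate on `tsupport ψ` -/
  rw [finsum_mem_eq_finite_toFinset_sum _ hMEfin, finsum_mem_eq_finite_toFinset_sum _ hMEfin]
  have halg : (δ : ℂ) ^ 2 * (∑ e ∈ MEf, ψ ((δ : ℂ) * hexMidpoint e) * F δ e) / F δ (b δ) -
      (cB : ℂ) * u * ((δ : ℂ) ^ 2 * ∑ e ∈ MEf, ψ ((δ : ℂ) * hexMidpoint e) *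
        Complex.exp ((5 / 8 : ℂ) * (L ((δ : ℂ) * hexMidpoint e) - Lb))) =
      (δ : ℂ) ^ 2 * ∑ e ∈ MEf, ψ ((δ : ℂ) * hexMidpoint e) *
        (F δ e / F δ (b δ) - (cB : ℂ) * u * E ((δ : ℂ) * hexMidpoint e)) := by
    rw [hE]
    simp only [Finset.mul_sum, Finset.sum_div, ← Finset.sum_sub_distrib]
    exact Finset.sum_congr rfl fun e _ => by ring
  rw [halg, norm_mul, Complex.norm_pow, Complex.norm_real, Real.norm_eq_abs, abs_of_pos hδ]
  have hvanish : ∀ e ∈ MEf, e ∉ T0 →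
      ‖ψ ((δ : ℂ) * hexMidpoint e) * (F δ e / F δ (b δ) - (cB : ℂ) * u * E ((δ : ℂ) * hexMidpoint e))‖
        = 0 := by
    intro e he hne
    rw [hT0, Finset.mem_filter, not_and] at hne
    rw [norm_mul, image_eq_zero_of_notMem_tsupport (hne he), norm_zero, zero_mul]
  have hsum_le : ‖∑ e ∈ MEf, ψ ((δ : ℂ) * hexMidpoint e) *
      (F δ e / F δ (b δ) - (cB : ℂ) * u * E ((δ : ℂ) * hexMidpoint e))‖ ≤
      ∑ e ∈ T0, (Mψ * κ * (εp + 1) * |f e - Hh e| + Mψ * MH * (εp * κ * Λb + τ)) := by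
    refine (norm_sum_le _ _).trans ?_
    rw [← Finset.sum_subset (Finset.filter_subset _ MEf) (fun e he hne => hvanish e he hne)]
    refine Finset.sum_le_sum fun e he => ?_
    rw [Finset.mem_filter, hmem] at he
    have heK'' : e ∈ hexDomainMidEdges (Λ δ) ∧ (δ : ℂ) * hexMidpoint e ∈ K'' :=
      ⟨he.1, hK'K'' (hK₀K' he.2)⟩
    obtain ⟨-, hph⟩ := hPδ e heK''
    rw [norm_mul]
    refine pointwise_bound hu (hEne _) (hMψ _) (norm_nonneg _) hκ0.le ?_ (hHhE e) hΛb0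
      (hMH1 _ he.2) hεp0.le ?_ hX
    · rw [norm_div, ← hρf e]
    · rw [hE]; simp only
      rw [exp_div_norm, exp_I_im_mul_sub]
      exact hph
  have hfinal := final_bound (εp := εp) (η := η) (τ := τ) hMψ0 hκle hκmax0 hεp0.le hη0.le hΛb0
    hMH0 hN0 hτ0.le hεp3 hη2 hτ2
  calc δ ^ 2 * ‖∑ e ∈ MEf, ψ ((δ : ℂ) * hexMidpoint e) *
        (F δ e / F δ (b δ) - (cB : ℂ) * u * E ((δ : ℂ) * hexMidpoint e))‖
      ≤ δ ^ 2 * ∑ e ∈ T0, (Mψ * κ * (εp + 1) * |f e - Hh e| + Mψ * MH * (εp * κ * Λb + τ)) :=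
        mul_le_mul_of_nonneg_left hsum_le hδ2.le
    _ = Mψ * κ * (εp + 1) * (δ ^ 2 * ∑ e ∈ T0, |f e - Hh e|) +
        Mψ * MH * (εp * κ * Λb + τ) * (δ ^ 2 * T0.card) := by
        rw [Finset.sum_add_distrib, Finset.sum_const, nsmul_eq_mul, ← Finset.mul_sum]; ring
    _ ≤ Mψ * κ * (εp + 1) * η + Mψ * MH * (εp * κ * Λb + τ) * N := by
        gcongr
    _ ≤ η₀ := hfinal

end Summit.CriticalPhenomena.SAWScalingLimit.Theorems.RetrievalSynthesisR

namespace Summit.CriticalPhenomena.SAWScalingLimit.Theorems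

open scoped BigOperators Topology ComplexConjugate
open Filter Set Metric MeasureTheory
open Literature.Probability.LatticeModels Literature.Probability.RandomPlanarGeometry
open Literature.Probability.RandomPlanarGeometry.SAW
open Literature.Barriers.CriticalPhenomena
open Summit.CriticalPhenomena.SAWScalingLimit.Theses.SAWPhaseRetrieval
open Summit.CriticalPhenomena.SAWScalingLimit.Theorems.RetrievalSynthesisR

/-- **`RetrievalSynthesisR` holds**: `PhaseLawR → RetrievalStabilityR → BoundaryAnchoring →
HexObservableLimitR`, with the universal constant `c = 2√3 · c_B · u`. -/
theorem retrievalSynthesisR_proof : RetrievalSynthesisR := by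
  intro hP hR hB
  obtain ⟨u, hu1, hP⟩ := hP
  obtain ⟨cB, hcB, hB⟩ := hB
  refine ⟨(2 * Real.sqrt 3 : ℂ) * cB * u, ?_, ?_⟩
  · have hu0 : u ≠ 0 := by rintro rfl; simp at hu1
    have h3 : (2 * Real.sqrt 3 : ℂ) ≠ 0 := by
      have : ((2 * Real.sqrt 3 : ℝ) : ℂ) ≠ 0 := by
        exact_mod_cast (by positivity : (2 * Real.sqrt 3 : ℝ) ≠ 0)
      push_cast at this
      exact this
    exact mul_ne_zero (mul_ne_zero h3 (by exact_mod_cast hcB.ne')) hu0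
  intro D ρ Λ m a b Φ L Lb ψ F hρ hflat hev hexh ha hb hΦ0 hΦ1 hLc hLexp hLb hψc hψs hψU
  have hP1 := hP D ρ Λ m a b Φ L Lb hρ hflat hev hexh ha hb hΦ0 hΦ1 hLc hLexp hLb
  have hB1 := hB D ρ Λ (m 1) a b hρ (hflat 1) (hev.mono fun δ h =>
    ⟨h.1, h.2.1, h.2.2.1, h.2.2.2.1, h.2.2.2.2.1, h.2.2.2.2.2.1, h.2.2.2.2.2.2 1⟩) hexh ha hb
  -- `L = log Φ'` is holomorphic
  have hf' : DifferentiableOn ℂ (deriv Φ) D.carrier :=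
    ((Φ.differentiableOn_coe.analyticOnNhd D.isOpen).deriv).differentiableOn
  have hLd : DifferentiableOn ℂ L D.carrier := differentiableOn_of_exp_eq D.isOpen hf' hLc hLexp
  have hR1 := hR D.carrier Λ L D.isOpen hLd hexh
  -- the vertex relations (DCS Lemma 1)
  have hRel : ∀ᶠ δ : ℝ in 𝓝[>] 0, SatisfiesVertexRelations (Λ δ) (F δ) :=
    hev.mono fun δ h => lemma1_iff.1 DuminilCopinSmirnov2012_lemma1_holds (Λ δ) h.1 (a δ) h.2.1
  -- the analytic core
  have hcore := core D.isOpen D.isConnected Λ hexh F b L Lb (D.pt 1) hLc hLb hψc hψs hψU hu1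
    hcB hRel hP1 hR1 hB1
  -- the Riemann sums of the limit density
  have hgc : Continuous fun z => ψ z * Complex.exp ((5 / 8 : ℂ) * (L z - Lb)) :=
    continuous_mul_exp_of_tsupport_subset D.isOpen hψc hψU hLc Lb
  have hgs : HasCompactSupport fun z => ψ z * Complex.exp ((5 / 8 : ℂ) * (L z - Lb)) :=
    hψs.mul_right
  have hgU : tsupport (fun z => ψ z * Complex.exp ((5 / 8 : ℂ) * (L z - Lb))) ⊆ D.carrier :=
    tsupport_mul_subset hψU
  have hRiem := tendsto_domain_sum D.isOpen Λ hexh hgc hgs hgU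
  -- `T_δ - c_B u R_δ → 0`
  have hdiff : Tendsto (fun δ : ℝ =>
      (δ : ℂ) ^ 2 * (∑ᶠ e ∈ hexDomainMidEdges (Λ δ), ψ ((δ : ℂ) * hexMidpoint e) * F δ e) /
          F δ (b δ) -
        (cB : ℂ) * u * ((δ : ℂ) ^ 2 * ∑ᶠ e ∈ hexDomainMidEdges (Λ δ),
          ψ ((δ : ℂ) * hexMidpoint e) *
            Complex.exp ((5 / 8 : ℂ) * (L ((δ : ℂ) * hexMidpoint e) - Lb))))
      (𝓝[>] 0) (𝓝 0) := by
    rw [Metric.tendsto_nhds]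
    intro ε hε
    filter_upwards [hcore (ε / 2) (half_pos hε)] with δ hδ
    rw [dist_zero_right]
    exact lt_of_le_of_lt hδ (half_lt_self hε)
  have hsum := hdiff.add (hRiem.const_mul ((cB : ℂ) * u))
  rw [zero_add] at hsum
  have hlim : (cB : ℂ) * u * (((2 * Real.sqrt 3 : ℝ) : ℂ) *
      ∫ z, ψ z * Complex.exp ((5 / 8 : ℂ) * (L z - Lb))) =
      2 * (Real.sqrt 3 : ℂ) * cB * u * ∫ z, ψ z * Complex.exp ((5 / 8 : ℂ) * (L z - Lb)) := by
    push_cast; ring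
  rw [hlim] at hsum
  refine hsum.congr fun δ => ?_
  ring

end Summit.CriticalPhenomena.SAWScalingLimit.Theorems
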